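import Summits.Ventures.HodgeRepro2.T5SU11SphericalTransformKernel

/-!
# The mass of the decaying solution: `∫_0^∞ χ_λ(s) sinh 2s ds = 1/(λ(λ − 2))` for `λ > 2`

The constant function `1 = φ_0 = φ_2` is the spherical function of the parameter `λ′ = 0` (`μ′ = 0`), and `2 − λ < 0 < 1` exactly
when `λ > 2`; row 629's transform in the reflected range then reads

* `integral_sphDecay_mul_sinh_eq` — **`∫_0^∞ χ_λ(s) sinh 2s ds = 1/(λ(λ − 2)) = 1/μ`** for `λ > 2` (the `sinh 2s`-mass of the
  decaying solution is the reciprocal of the spectral parameter — consistent with row 544's `G^I_λ 1 = −1/μ` read at the origin);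
* `integrableOn_sphDecay_mul_sinh` — the mass is finite for `λ > 2`;
* `integral_sphDecay_mul_sinh_pos` — and positive;
* `tendsto_integral_sphDecay_mul_sinh_nhdsGT_two` — **it blows up as `λ → 2⁺`** (`χ_λ sinh 2s` ceases to be integrable at `λ = 2`).

Nothing is claimed about (N).

Blind lane: Mathlib + the HodgeRepro2 prefix only; no sorry; axioms ⊆ {propext, Classical.choice,
Quot.sound}.
-/

namespace Summit.Ventures.HodgeRepro2.T5SU11SphericalDecayMass

open Filter Topology MeasureTheory
open Set (Ioi Ioc)
open T5SU11Cartan T5SU11SphericalFunction T5SU11SphericalSymmetry T5SU11SphericalDecay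
  T5SU11RadialGreenImproperDecaySource T5SU11SphericalTransformKernel

section measure

variable [MeasurableSpace Circle] [BorelSpace Circle]

variable {lam : ℝ} (h2 : 2 < lam)

include h2 in
/-- **`∫_0^∞ χ_λ(s) sinh 2s ds = 1/(λ(λ − 2))`** for `λ > 2`. -/
theorem integral_sphDecay_mul_sinh_eq :
    ∫ s in Ioi 0, sphDecay lam s * Real.sinh (2 * s) = 1 / (lam * (lam - 2)) := by
  have hlam : 1 < lam := by linarith
  have h := integral_sphDecay_mul_sph_eq' hlam (lam' := 0) (by linarith) one_pos
  have e : (fun s => sphDecay lam s * sph 0 (hyp s) * Real.sinh (2 * s)) = fun s => sphDecay lam s * Real.sinh (2 * s) := by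
    funext s
    rw [sph_zero, mul_one]
  rw [e] at h
  rw [h]
  norm_num

include h2 in
/-- `χ_λ sinh 2s` is integrable on `(0, ∞)` for `λ > 2`. -/
theorem integrableOn_sphDecay_mul_sinh : IntegrableOn (fun s => sphDecay lam s * Real.sinh (2 * s)) (Ioi 0) := by
  have hlam : 1 < lam := by linarith
  have hg : ContinuousOn (fun _ : ℝ => (1 : ℝ)) (Ioi 0) := continuousOn_const
  have hM : ∀ s ∈ Ioc (0 : ℝ) 1, |(fun _ : ℝ => (1 : ℝ)) s| ≤ 1 := fun s _ => by simp
  have hC : ∀ s : ℝ, (0 : ℝ) ≤ s → |(fun _ : ℝ => (1 : ℝ)) s| ≤ 1 * Real.exp (-(0 : ℝ) * s) := fun s _ => by simp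
  have hε : 2 - lam < 0 := by linarith
  have h := integrableOn_sphDecay_mul_mul_sinh hlam hg hM zero_le_one hε hC
  simpa only [mul_one] using h

include h2 in
/-- The mass of the decaying solution is positive. -/
theorem integral_sphDecay_mul_sinh_pos : 0 < ∫ s in Ioi 0, sphDecay lam s * Real.sinh (2 * s) := by
  rw [integral_sphDecay_mul_sinh_eq h2]
  exact div_pos one_pos (mul_pos (by linarith) (by linarith))

/-- **The mass of the decaying solution blows up as `λ → 2⁺`**: `∫_0^∞ χ_λ sinh 2s ds → +∞`. -/
theorem tendsto_integral_sphDecay_mul_sinh_nhdsGT_two :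
    Tendsto (fun lam => ∫ s in Ioi 0, sphDecay lam s * Real.sinh (2 * s)) (𝓝[>] 2) atTop := by
  have h1 : Tendsto (fun lam : ℝ => lam * (lam - 2)) (𝓝[>] 2) (𝓝[>] 0) := by
    rw [tendsto_nhdsWithin_iff]
    refine ⟨?_, ?_⟩
    · have : Tendsto (fun lam : ℝ => lam * (lam - 2)) (𝓝 2) (𝓝 (2 * (2 - 2))) :=
        (continuous_id.mul (continuous_id.sub continuous_const)).tendsto 2
      simpa using this.mono_left nhdsWithin_le_nhds
    · filter_upwards [self_mem_nhdsWithin] with lam hlam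
      have hlam' : (2 : ℝ) < lam := hlam
      exact mul_pos (by linarith) (sub_pos.mpr hlam')
  have h := tendsto_inv_nhdsGT_zero.comp h1
  refine h.congr' ?_
  filter_upwards [self_mem_nhdsWithin] with lam hlam
  simp only [Function.comp]
  rw [integral_sphDecay_mul_sinh_eq hlam, one_div]

end measure

end Summit.Ventures.HodgeRepro2.T5SU11SphericalDecayMass
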